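import Summits.KontsevichZagierPeriods.KontsevichZagierPeriods.Theorems.RealOnePeriodRelations.Negative.Kit
import Summits.KontsevichZagierPeriods.KontsevichZagierPeriods.Theorems.HermiteRigidityGenusTwoCycleTransferPushforwardDimOne
import Literature.NumberTheory.Transcendental.KZCalculusProofs
import Literature.NumberTheory.Transcendental.KZSemialgebraicComplex
import Literature.NumberTheory.Transcendental.SemialgebraicLineDeriv
import Literature.NumberTheory.Transcendental.SemialgebraicDerivativeProofs

/-!
# `RealOnePeriodRelations` (stmt-KontsevichZagierPeriods-10042), line `nash-retraction-thin-strip`: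
# stub `stub_arcSymbols`, auxiliary file 4 — pulling a one-dimensional representation back to
# the unit interval (rule 2)

Given a representation `r'` in dimension one whose domain is the image `φ((0,1))` of the unit
interval under a `ℚ`-semialgebraic function `φ`, differentiable with nowhere-zero derivative and
injective on `(0,1)`, we BUILD the pulled-back representation `R = [∫_{(0,1)} r'(φ(s)) |φ′(s)| ds]`
(semialgebraic: derivatives of semialgebraic functions are semialgebraic, Basu–Pollack–Roy
Prop. 3.22 = tree theorem `IsSemialgebraicFunOn.hasDerivAt_isSemialgebraic_holds`; integrable by
Mathlib's Jacobian criterion) and exhibit `[R] − [r']` as ONE element of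
`KZ.changeOfVariablesRel` (`exists_pullback`). The substitution used by the piece reduction of the
stub is `φ(s) = p + σ·C·s^q` (`σ = ±1`, `C > 0`, `q ≥ 1`, `p`, `C` algebraic): we record its
elementary properties (`powSubst_*`). Finally, integrability on `{z : ℝ¹ | z 0 ∈ S}` is
integrability on `S ⊆ ℝ` (`integrableOn_comp_apply_iff`).

References: M. Kontsevich, D. Zagier, *Periods* (2001), §1.2 rule (2); S. Basu, R. Pollack,
M.-F. Roy, *Algorithms in Real Algebraic Geometry* (2006), Prop. 3.22.
-/

noncomputable section

open scoped BigOperators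
open Set MeasureTheory
open Literature.NumberTheory.Transcendental
open Literature.ModelTheory.ExponentialFields (IsSemialgebraic)
open Summit.KontsevichZagierPeriods.HermiteRigidity.GenusTwoCycleTransfer (det_smul_id_fin_one
  hasFDerivAt_fin_one)

namespace Summit.KontsevichZagierPeriods.SymplecticScissors.RealOnePeriodRelations

namespace ArcSymbols

/-! ## Integrability on `ℝ¹` versus `ℝ` -/

/-- `{z : ℝ¹ | z 0 ∈ S}` is the preimage of `S` under the canonical identification `ℝ¹ ≃ ℝ`.
[folklore] -/
theorem funUnique_preimage (S : Set ℝ) :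
    (MeasurableEquiv.funUnique (Fin 1) ℝ) ⁻¹' S = {z : Fin 1 → ℝ | z 0 ∈ S} := by
  ext z
  simp [MeasurableEquiv.funUnique_apply, Fin.default_eq_zero]

/-- Integrability of `z ↦ G (z 0)` on `{z : ℝ¹ | z 0 ∈ S}` is integrability of `G` on `S`.
[folklore] -/
theorem integrableOn_comp_apply_iff (G : ℝ → ℝ) (S : Set ℝ) :
    IntegrableOn (fun z : Fin 1 → ℝ => G (z 0)) {z : Fin 1 → ℝ | z 0 ∈ S} ↔ IntegrableOn G S := by
  have hmp : MeasurePreserving (MeasurableEquiv.funUnique (Fin 1) ℝ) volume volume :=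
    volume_preserving_funUnique (Fin 1) ℝ
  have h := hmp.integrableOn_comp_preimage (MeasurableEquiv.measurableEmbedding _) (f := G) (s := S)
  rw [funUnique_preimage] at h
  exact h

/-! ## The pull-back to the unit interval -/

/-- **Rule 2, pulled back to `(0,1)`.** If `r'.domain = Φ((0,1))`, `Φ(z) = (φ(z 0))`, with `φ`
`ℚ`-semialgebraic on `(0,1)`, differentiable there (derivative `φ′`) and injective, then `R = [∫_{(0,1)} r'(φ s)|φ′ s| ds]` is a representation and `[R] − [r'] ∈ changeOfVariablesRel`.
[cite: KontsevichZagier2001, §1.2 rule (2)] -/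
theorem exists_pullback (r' : KZ.IntegralRep 1) (φ φ' : ℝ → ℝ)
    (hφ : IsSemialgebraicFunOn ℚ {z : Fin 1 → ℝ | z 0 ∈ Set.Ioo (0 : ℝ) 1} (fun z => φ (z 0)))
    (hder : ∀ s ∈ Set.Ioo (0 : ℝ) 1, HasDerivAt φ (φ' s) s) (hinj : InjOn φ (Set.Ioo (0 : ℝ) 1))
    (hdom : r'.domain = (fun z : Fin 1 → ℝ => fun _ : Fin 1 => φ (z 0)) '' {z : Fin 1 → ℝ | z 0 ∈ Set.Ioo (0 : ℝ) 1}) :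
    ∃ R : KZ.IntegralRep 1, R.domain = {z : Fin 1 → ℝ | z 0 ∈ Set.Ioo (0 : ℝ) 1} ∧
      (∀ z, R.integrand z = r'.integrand (fun _ => φ (z 0)) * |φ' (z 0)|) ∧
      KZ.of R - KZ.of r' ∈ KZ.changeOfVariablesRel := by
  set U : Set (Fin 1 → ℝ) := {z : Fin 1 → ℝ | z 0 ∈ Set.Ioo (0 : ℝ) 1} with hU
  set Φ : (Fin 1 → ℝ) → (Fin 1 → ℝ) := fun z _ => φ (z 0) with hΦ
  set Φ' : (Fin 1 → ℝ) → ((Fin 1 → ℝ) →L[ℝ] (Fin 1 → ℝ)) :=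
    fun z => φ' (z 0) • ContinuousLinearMap.id ℝ (Fin 1 → ℝ) with hΦ'
  have hUsa : IsSemialgebraic ℚ U := IsSemialgebraicFunOn.isSemialgebraic_holds hφ
  have hUmeas : MeasurableSet U := measurableSet_Ioo.preimage (measurable_pi_apply 0)
  have hφ'sa : IsSemialgebraicFunOn ℚ U (fun z => φ' (z 0)) :=
    IsSemialgebraicFunOn.hasDerivAt_isSemialgebraic_holds 0 1 φ φ' zero_lt_one hφ hder
  have hΦsa : IsSemialgebraicMapOn ℚ U Φ := IsSemialgebraicMapOn.of_forall hUsa fun _ => hφ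
  have hinjΦ : InjOn Φ U := by
    intro z hz z' hz' h
    have h0 : φ (z 0) = φ (z' 0) := congrFun h 0
    funext i
    rw [Fin.fin_one_eq_zero i]
    exact hinj hz hz' h0
  have hderiv : ∀ z ∈ U, HasFDerivWithinAt Φ (Φ' z) U z := fun z hz =>
    (hasFDerivAt_fin_one φ (φ' (z 0)) z (hder _ hz)).hasFDerivWithinAt
  have hdet : ∀ z, (Φ' z).det = φ' (z 0) := fun z => det_smul_id_fin_one (φ' (z 0))
  have hmaps : MapsTo Φ U r'.domain := fun z hz => by
    rw [hdom]
    exact ⟨z, hz, rfl⟩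
  -- the pulled-back integrand
  set f : (Fin 1 → ℝ) → ℝ := fun z => r'.integrand (Φ z) * |φ' (z 0)| with hf
  have hf_sa : IsSemialgebraicFunOn ℚ U f :=
    (IsSemialgebraicFunOn.comp_isSemialgebraicMapOn_holds r'.isSemialgebraicFunOn_integrand hΦsa
      hmaps).fun_mul hφ'sa.abs
  have hf_int : IntegrableOn f U := by
    have h := r'.integrableOn
    rw [hdom, integrableOn_image_iff_integrableOn_abs_det_fderiv_smul volume hUmeas hderiv hinjΦ] at h
    refine h.congr_fun (fun z _ => ?_) hUmeas
    show |(Φ' z).det| • r'.integrand (Φ z) = f z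
    rw [smul_eq_mul, mul_comm, hdet]
  refine ⟨⟨U, f, hUsa, hf_sa, hf_int⟩, rfl, fun z => rfl, ?_⟩
  exact ⟨1, ⟨U, f, hUsa, hf_sa, hf_int⟩, r', Φ, Φ', hΦsa, hderiv, hinjΦ, hdom, fun z _ => by
    show f z = r'.integrand (Φ z) * |(Φ' z).det|
    rw [hdet], rfl⟩

/-! ## The substitution `φ(s) = p + σ C s^q` -/

/-- `s ↦ s ^ q` maps `(0,1)` onto `(0,1)` for `q ≥ 1`. [folklore] -/
theorem pow_image_Ioo {q : ℕ} (hq : 0 < q) : (fun s : ℝ => s ^ q) '' Set.Ioo (0 : ℝ) 1 = Set.Ioo 0 1 := by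
  have hq0 : q ≠ 0 := Nat.pos_iff_ne_zero.mp hq
  refine Subset.antisymm ?_ ?_
  · rintro _ ⟨s, hs, rfl⟩
    exact ⟨pow_pos hs.1 q, pow_lt_one₀ hs.1.le hs.2 hq0⟩
  · intro y hy
    have hcont : ContinuousOn (fun s : ℝ => s ^ q) (Set.Icc 0 1) := (continuous_pow q).continuousOn
    have h := intermediate_value_Ioo zero_le_one hcont
    simp only [zero_pow hq0, one_pow] at h
    exact h hy

/-- Properties of the substitution `φ(s) = p + σ·C·s^q` on `(0,1)` (`σ = ±1`, `C > 0`, `q ≥ 1`,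
`p`, `C` algebraic): `ℚ`-semialgebraic, derivative `σ C q s^{q−1} ≠ 0` with absolute value
`q C s^{q−1}`, injective, with image the open interval from `p` to `p + σ C`. [folklore] -/
theorem powSubst_props (p C σ : ℝ) (q : ℕ) (hq : 0 < q) (hC : 0 < C) (hσ : σ = 1 ∨ σ = -1)
    (hp : IsAlgebraic ℚ p) (hCa : IsAlgebraic ℚ C) :
    IsSemialgebraicFunOn ℚ {z : Fin 1 → ℝ | z 0 ∈ Set.Ioo (0 : ℝ) 1} (fun z => p + σ * C * (z 0) ^ q) ∧
    (∀ s : ℝ, HasDerivAt (fun s => p + σ * C * s ^ q) (σ * C * (q * s ^ (q - 1))) s) ∧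
    (∀ s ∈ Set.Ioo (0 : ℝ) 1, σ * C * (q * s ^ (q - 1)) ≠ 0) ∧
    (∀ s ∈ Set.Ioo (0 : ℝ) 1, |σ * C * (q * s ^ (q - 1))| = q * C * s ^ (q - 1)) ∧
    InjOn (fun s => p + σ * C * s ^ q) (Set.Ioo (0 : ℝ) 1) ∧
    (fun z : Fin 1 → ℝ => fun _ : Fin 1 => p + σ * C * (z 0) ^ q) '' {z : Fin 1 → ℝ | z 0 ∈ Set.Ioo (0 : ℝ) 1} =
      {z : Fin 1 → ℝ | z 0 ∈ (fun y => p + σ * C * y) '' Set.Ioo (0 : ℝ) 1} := by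
  have hq0 : q ≠ 0 := Nat.pos_iff_ne_zero.mp hq
  have hσ0 : σ ≠ 0 := by rcases hσ with h | h <;> rw [h] <;> norm_num
  have hσa : IsAlgebraic ℚ σ := by
    rcases hσ with h | h <;> rw [h]
    · exact isAlgebraic_one
    · exact isAlgebraic_one.neg
  have hU : IsSemialgebraic ℚ {z : Fin 1 → ℝ | z 0 ∈ Set.Ioo (0 : ℝ) 1} := by
    have h1 := Literature.ModelTheory.ExponentialFields.isSemialgebraic_setOf_eval_pos (k := ℚ)
      (R := ℝ) (MvPolynomial.X (0 : Fin 1) : MvPolynomial (Fin 1) ℚ)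
    have h2 := Literature.ModelTheory.ExponentialFields.isSemialgebraic_setOf_eval_pos (k := ℚ)
      (R := ℝ) (1 - MvPolynomial.X (0 : Fin 1) : MvPolynomial (Fin 1) ℚ)
    convert h1.inter h2 using 1
    ext z
    simp [sub_pos]
  have hX : IsSemialgebraicFunOn ℚ {z : Fin 1 → ℝ | z 0 ∈ Set.Ioo (0 : ℝ) 1} (fun z => z 0) :=
    (isSemialgebraicFunOn_aeval hU (MvPolynomial.X 0)).congr fun z _ => by simp
  refine ⟨?_, fun s => ?_, fun s hs => ?_, fun s hs => ?_, ?_, ?_⟩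
  · exact (isSemialgebraicFunOn_const_of_isAlgebraic hU hp).fun_add
      (((isSemialgebraicFunOn_const_of_isAlgebraic hU hσa).fun_mul
        (isSemialgebraicFunOn_const_of_isAlgebraic hU hCa)).fun_mul (hX.fun_pow q))
  · have h := ((hasDerivAt_pow q s).const_mul (σ * C)).const_add p
    simpa using h
  · exact mul_ne_zero (mul_ne_zero hσ0 hC.ne') (mul_ne_zero (Nat.cast_ne_zero.mpr hq0)
      (pow_ne_zero _ hs.1.ne'))
  · rw [abs_mul, abs_mul, abs_of_pos hC, abs_of_nonneg (mul_nonneg (Nat.cast_nonneg q)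
      (pow_nonneg hs.1.le _))]
    rcases hσ with h | h <;> rw [h] <;> simp [mul_comm, mul_assoc]
  · intro s hs s' hs' h
    have h1 : s ^ q = s' ^ q := by
      have := mul_left_cancel₀ (mul_ne_zero hσ0 hC.ne') (add_left_cancel h)
      exact this
    exact (pow_left_inj₀ hs.1.le hs'.1.le hq0).mp h1
  · ext w
    simp only [Set.mem_image, Set.mem_setOf_eq]
    constructor
    · rintro ⟨z, hz, rfl⟩
      exact ⟨(z 0) ^ q, ⟨pow_pos hz.1 q, pow_lt_one₀ hz.1.le hz.2 hq0⟩, rfl⟩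
    · rintro ⟨y, hy, hyw⟩
      have hy' : y ∈ (fun s : ℝ => s ^ q) '' Set.Ioo (0 : ℝ) 1 := by rw [pow_image_Ioo hq]; exact hy
      obtain ⟨s, hs, rfl⟩ := hy'
      refine ⟨fun _ => s, hs, ?_⟩
      funext i
      rw [Fin.fin_one_eq_zero i, ← hyw]

/-- The image of `(0,1)` under `y ↦ p + C y` (`C > 0`) is `(p, p + C)`. [folklore] -/
theorem affine_image_Ioo_pos (p C : ℝ) (hC : 0 < C) :
    (fun y => p + 1 * C * y) '' Set.Ioo (0 : ℝ) 1 = Set.Ioo p (p + C) := by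
  ext x
  simp only [Set.mem_image, Set.mem_Ioo, one_mul]
  constructor
  · rintro ⟨y, ⟨h1, h2⟩, rfl⟩
    exact ⟨by nlinarith, by nlinarith⟩
  · rintro ⟨h1, h2⟩
    refine ⟨(x - p) / C, ⟨div_pos (by linarith) hC, (div_lt_one hC).mpr (by linarith)⟩, ?_⟩
    field_simp
    ring

/-- The image of `(0,1)` under `y ↦ p − C y` (`C > 0`) is `(p − C, p)`. [folklore] -/
theorem affine_image_Ioo_neg (p C : ℝ) (hC : 0 < C) :
    (fun y => p + (-1) * C * y) '' Set.Ioo (0 : ℝ) 1 = Set.Ioo (p - C) p := by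
  ext x
  simp only [Set.mem_image, Set.mem_Ioo, neg_mul]
  constructor
  · rintro ⟨y, ⟨h1, h2⟩, rfl⟩
    exact ⟨by nlinarith, by nlinarith⟩
  · rintro ⟨h1, h2⟩
    refine ⟨(p - x) / C, ⟨div_pos (by linarith) hC, (div_lt_one hC).mpr (by linarith)⟩, ?_⟩
    field_simp
    ring

end ArcSymbols

/-- **Registered anchor `helper_arcSymbols_4`** (integrability on `{z : ℝ¹ | z 0 ∈ S}` is
integrability on `S`). [folklore] -/
theorem helper_arcSymbols_4 : ∀ (G : ℝ → ℝ) (S : Set ℝ), MeasureTheory.IntegrableOn (fun z : Fin 1 → ℝ => G (z 0)) {z : Fin 1 → ℝ | z 0 ∈ S} ↔ MeasureTheory.IntegrableOn G S :=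
  ArcSymbols.integrableOn_comp_apply_iff

end Summit.KontsevichZagierPeriods.SymplecticScissors.RealOnePeriodRelations

end
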